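import Summits.HubbardSuperconductivity.HubbardSuperconductivity.Theorems.DeformationLadderLadderThesisRigidityReduction
import Summits.HubbardSuperconductivity.HubbardSuperconductivity.Theses.TwistGap

/-!
# Route `DeformationLadder`, crux `LadderThesis` (item `stmt-HubbardSuperconductivity-1890`):
# normal forms — the uniform penalty gap, low-energy rigidity, and TwistGap's `S⁺`

`LadderThesis` (X of route `DeformationLadder`): for some `U > 0`, `δ ∈ (0,1/2)`, `s > 0`, `a > 0`
and all large even `L`, SOME normalised `(N_L, S^z = 0)`-sector ground state `φ` of the penalised
pure model `H_L + (s/L⁴)·Δ_dᴴΔ_d` (`H_L = hubbardTorus 2 L 1 U`, `Δ_d = pairField dWaveFormFactor L`)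
has `d`-wave LRO density `L⁻⁴ Re⟨φ, Δ_dᴴΔ_d φ⟩ ≥ a`.

This support file (`--supports stmt-HubbardSuperconductivity-1890`) does not settle X — it is
conjecture-grade (phase-rigid `d`-wave superconductivity of the two-dimensional Hubbard ground
state; with `Assembly` it implies the summit). It proves, sorry-free, that X is EQUIVALENT to three
other statements filed on the ledger, by elementary finite-dimensional implications with explicit
constants:

* `penaltyGap_ge_of_groundState`, `lro_ge_of_penaltyGap` — the two pointwise (fixed `L`, fixed
  sector) slope inequalities behind everything else: a penalised ground state with LRO `≥ a` forces
  `E_s − E₀ ≥ a s`; a gap `E_s − E₀ ≥ a s` forces LRO `≥ (a s − κ)/s` on every unit sector vector of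
  `H_L`-energy `≤ E₀ + κ`;
* `penaltyGap_of_ladderThesis` — X ⇒ the uniform PENALTY GAP
  `minEnergyOn (H_L + (s/L⁴)Δ_dᴴΔ_d) K_L − minEnergyOn H_L K_L ≥ a·s` eventually in even `L`
  (`K_L = szSector N_L 0`; the "L-uniform slope of the concave penalised energy");
* `lowEnergyRigidity_of_penaltyGap` — gap ⇒ `LowEnergyRigidity` (this route's rank-2 crux,
  `stmt-HubbardSuperconductivity-1892`) with `(κ, a') = (a s/2, a/2)`;
* `lowEnergyRigidity_of_ladderThesis`, `ladderThesis_iff_lowEnergyRigidity` — with the landed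
  reduction `ladderThesis_of_lowEnergyRigidity`, the target and the corner crux COINCIDE;
* `ladderThesis_of_penaltyGap`, `ladderThesis_iff_penaltyGap` — X ↔ gap;
* `tgThesis_of_penaltyGap`, `lowEnergyRigidity_of_tgThesis`, `ladderThesis_iff_tgThesis`,
  `lowEnergyRigidity_iff_tgThesis` — X ↔ route TwistGap's target `S⁺` (`TgThesis`,
  `stmt-HubbardSuperconductivity-1508`: `c ≤ L⁻⁴⟨Δ_dᴴΔ_d⟩_φ + λ(⟨H_L⟩_φ − E₀)` on unit sector
  vectors) with `(λ, c) = (1/s, a)` one way and `(κ, a) = (c/(2λ), c/2)` the other.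

So routes `DeformationLadder` and `TwistGap` have one and the same target up to constants, and it
is O(1)-scale phase rigidity of the pure model.

Sources: T. A. Kaplan, P. Horsch, W. von der Linden, J. Phys. Soc. Jpn. 58 (1989) 3894 (variational
comparison); R. B. Griffiths, J. Math. Phys. 5 (1964) 1215 and T. Kato, *Perturbation Theory for
Linear Operators* (1966) II-§5.4 (slopes of the concave penalised energy); H. Tasaki, *Physics and
Mathematics of Quantum Many-Body Systems* (2020) §2.1–2.2 (variational principle). All folklore
linear algebra; no definition is introduced.
-/

set_option linter.dupNamespace false

noncomputable section

namespace Summit.HubbardSuperconductivity.HubbardSuperconductivity.Theorems.DeformationLadder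

open Matrix Literature.MathematicalPhysics.QuantumLattice Literature.Probability.LatticeModels
open Summit.HubbardSuperconductivity.HubbardSuperconductivity.Theses.DeformationLadder
open Summit.HubbardSuperconductivity.HubbardSuperconductivity.Theses.TwistGap (TgThesis)
open scoped Matrix.Norms.L2Operator ComplexOrder

/-! ### Pointwise (fixed side `L`, fixed sector) slope inequalities -/

section Pointwise

variable (L : ℕ) [NeZero L]

/-- **Lower slope bound at a penalised ground state** (fixed `L`, sector `(N, S^z = 0)`): if a
normalised sector ground state `φ` of `H_L + (s/L⁴)Δ_dᴴΔ_d` (`s ≥ 0`) has LRO density `≥ a`, then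
the penalised sector energy exceeds the pure one by at least `a·s`:
`E_s = Re⟨φ, H_L φ⟩ + (s/L⁴)Re⟨φ, Δ_dᴴΔ_d φ⟩ ≥ E₀ + a s` (variational principle for `H_L` at `φ`).
The Feynman–Hellmann direction of the Danskin/Kato slope calculus of the concave penalised energy.
Kato (1966) II-§5.4; Griffiths, J. Math. Phys. 5 (1964) 1215. [cite: KaplanHorschVonDerLinden1989] -/
theorem penaltyGap_ge_of_groundState (U : ℝ) {s a : ℝ} (hs : 0 ≤ s) (N : ℕ)
    {φ : Fock (Orb (FermionTorus 2 L))} (hφ1 : star φ ⬝ᵥ φ = 1)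
    (hφ : IsGroundStateInSector (hubbardTorus 2 L 1 U + ((s / (L : ℝ) ^ 4 : ℝ) : ℂ) •
      ((pairField dWaveFormFactor L)ᴴ * pairField dWaveFormFactor L)) N 0 φ)
    (ha : a ≤ (expect ((pairField dWaveFormFactor L)ᴴ * pairField dWaveFormFactor L) φ).re /
      (L : ℝ) ^ 4) :
    a * s ≤ (hubbardTorus 2 L 1 U + ((s / (L : ℝ) ^ 4 : ℝ) : ℂ) •
        ((pairField dWaveFormFactor L)ᴴ * pairField dWaveFormFactor L)).minEnergyOn (szSector N 0) -
      (hubbardTorus 2 L 1 U).minEnergyOn (szSector N 0) := by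
  obtain ⟨hmem, -, heig⟩ := hφ
  have hL4 : (0 : ℝ) < (L : ℝ) ^ 4 := by
    have : (0 : ℝ) < L := by exact_mod_cast Nat.pos_of_ne_zero (NeZero.ne L)
    positivity
  set P := (pairField dWaveFormFactor L)ᴴ * pairField dWaveFormFactor L with hP
  set Es := (hubbardTorus 2 L 1 U + ((s / (L : ℝ) ^ 4 : ℝ) : ℂ) • P).minEnergyOn
    (szSector N 0) with hEs
  -- the penalised energy of `φ` is the penalised sector energy
  have h1 : (star φ ⬝ᵥ (hubbardTorus 2 L 1 U + ((s / (L : ℝ) ^ 4 : ℝ) : ℂ) • P) *ᵥ φ).re = Es := by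
    rw [heig, dotProduct_smul, hφ1, smul_eq_mul, mul_one, Complex.ofReal_re]
  rw [add_mulVec, dotProduct_add, Complex.add_re, smul_mulVec, dotProduct_smul,
    smul_eq_mul, Complex.re_ofReal_mul] at h1
  -- the pure sector energy is below the `H_L`-energy of `φ`
  have h2 := minEnergyOn_le_re_rayleigh (hubbardTorus 2 L 1 U) (szSector N 0) hmem hφ1
  -- the LRO hypothesis
  rw [expect, le_div_iff₀ hL4] at ha
  have h3 : a * s ≤ s / (L : ℝ) ^ 4 * (star φ ⬝ᵥ P *ᵥ φ).re :=
    calc a * s = s / (L : ℝ) ^ 4 * (a * (L : ℝ) ^ 4) := by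
          rw [div_mul_eq_mul_div, mul_left_comm, mul_div_assoc, mul_div_cancel_right₀ _ hL4.ne',
            mul_comm]
      _ ≤ s / (L : ℝ) ^ 4 * (star φ ⬝ᵥ P *ᵥ φ).re :=
          mul_le_mul_of_nonneg_left ha (div_nonneg hs hL4.le)
  linarith

/-- **Upper slope bound from a penalty gap** (fixed `L`, sector `(N, S^z = 0)`): if
`minEnergyOn (H_L + (s/L⁴)Δ_dᴴΔ_d) − minEnergyOn H_L ≥ a·s` with `s > 0`, then every unit sector
vector `φ` with `Re⟨φ, H_L φ⟩ ≤ E₀ + κ` has LRO density `≥ (a s − κ)/s`: by the variational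
principle for the penalised matrix, `E₀ + a s ≤ E_s ≤ Re⟨φ, H_L φ⟩ + s·LRO(φ) ≤ E₀ + κ + s·LRO(φ)`.
Kaplan–Horsch–von der Linden, J. Phys. Soc. Jpn. 58 (1989) 3894; Tasaki (2020) §2.1.
[cite: KaplanHorschVonDerLinden1989] -/
theorem lro_ge_of_penaltyGap (U : ℝ) {s a κ : ℝ} (hs : 0 < s) (N : ℕ)
    (hgap : a * s ≤ (hubbardTorus 2 L 1 U + ((s / (L : ℝ) ^ 4 : ℝ) : ℂ) •
        ((pairField dWaveFormFactor L)ᴴ * pairField dWaveFormFactor L)).minEnergyOn (szSector N 0) -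
      (hubbardTorus 2 L 1 U).minEnergyOn (szSector N 0))
    {φ : Fock (Orb (FermionTorus 2 L))} (hmem : φ ∈ szSector (Λ := FermionTorus 2 L) N 0)
    (hφ1 : star φ ⬝ᵥ φ = 1)
    (hE : (star φ ⬝ᵥ hubbardTorus 2 L 1 U *ᵥ φ).re ≤
      (hubbardTorus 2 L 1 U).minEnergyOn (szSector N 0) + κ) :
    (a * s - κ) / s ≤
      (expect ((pairField dWaveFormFactor L)ᴴ * pairField dWaveFormFactor L) φ).re / (L : ℝ) ^ 4 := by
  have hL4 : (0 : ℝ) < (L : ℝ) ^ 4 := by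
    have : (0 : ℝ) < L := by exact_mod_cast Nat.pos_of_ne_zero (NeZero.ne L)
    positivity
  set P := (pairField dWaveFormFactor L)ᴴ * pairField dWaveFormFactor L with hP
  -- variational principle for the penalised matrix at the trial vector `φ`
  have h1 := minEnergyOn_le_re_rayleigh
    (hubbardTorus 2 L 1 U + ((s / (L : ℝ) ^ 4 : ℝ) : ℂ) • P) (szSector N 0) hmem hφ1
  rw [add_mulVec, dotProduct_add, Complex.add_re, smul_mulVec, dotProduct_smul,
    smul_eq_mul, Complex.re_ofReal_mul] at h1
  have h2 : a * s - κ ≤ s / (L : ℝ) ^ 4 * (star φ ⬝ᵥ P *ᵥ φ).re := by linarith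
  rw [expect, div_le_iff₀ hs, div_mul_eq_mul_div, le_div_iff₀ hL4]
  calc (a * s - κ) * (L : ℝ) ^ 4 ≤ s / (L : ℝ) ^ 4 * (star φ ⬝ᵥ P *ᵥ φ).re * (L : ℝ) ^ 4 :=
        mul_le_mul_of_nonneg_right h2 hL4.le
    _ = (star φ ⬝ᵥ P *ᵥ φ).re * s := by
        rw [div_mul_eq_mul_div, div_mul_cancel_of_imp (fun h => absurd h hL4.ne')]
        ring

end Pointwise

/-! ### Normal forms of the crux: the uniform penalty gap and low-energy rigidity -/

section NormalForms

/-- **`LadderThesis` forces a uniform penalty gap** (`penaltyGap_ge_of_groundState` at the ground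
state supplied by X): `minEnergyOn (H_L + (s/L⁴)Δ_dᴴΔ_d) K_L − minEnergyOn H_L K_L ≥ a·s` at every
large even `L` — the "L-uniform slope of the concave penalised energy". Kato (1966) II-§5.4;
Griffiths, J. Math. Phys. 5 (1964) 1215. [cite: KaplanHorschVonDerLinden1989] -/
theorem penaltyGap_of_ladderThesis (h : LadderThesis) :
    ∃ U : ℝ, 0 < U ∧ ∃ δ ∈ Set.Ioo (0:ℝ) (1 / 2), ∃ s : ℝ, 0 < s ∧ ∃ a : ℝ, 0 < a ∧ ∃ L₀ : ℕ,
      ∀ (L : ℕ) [NeZero L], L₀ ≤ L → Even L →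
        a * s ≤ (hubbardTorus 2 L 1 U + ((s / (L : ℝ) ^ 4 : ℝ) : ℂ) •
            ((pairField dWaveFormFactor L)ᴴ * pairField dWaveFormFactor L)).minEnergyOn
            (szSector (2 * ⌊(1 - δ) * (L : ℝ) ^ 2 / 2⌋₊) 0) -
          (hubbardTorus 2 L 1 U).minEnergyOn (szSector (2 * ⌊(1 - δ) * (L : ℝ) ^ 2 / 2⌋₊) 0) := by
  obtain ⟨U, hU, δ, hδ, s, hs, a, ha, L₀, h⟩ := h
  refine ⟨U, hU, δ, hδ, s, hs, a, ha, L₀, fun L _ hL hev => ?_⟩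
  obtain ⟨φ, hφ1, hφ, hlro⟩ := h L hL hev
  exact penaltyGap_ge_of_groundState L U hs.le _ hφ1 hφ hlro

/-- **A uniform penalty gap forces low-energy rigidity** (`lro_ge_of_penaltyGap` with
`κ = a s/2`, giving LRO density `≥ (a s − a s/2)/s = a/2`). Kaplan–Horsch–von der Linden, J. Phys.
Soc. Jpn. 58 (1989) 3894; Tasaki (2020) §2.1. [cite: KaplanHorschVonDerLinden1989] -/
theorem lowEnergyRigidity_of_penaltyGap
    (h : ∃ U : ℝ, 0 < U ∧ ∃ δ ∈ Set.Ioo (0:ℝ) (1 / 2), ∃ s : ℝ, 0 < s ∧ ∃ a : ℝ, 0 < a ∧ ∃ L₀ : ℕ,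
      ∀ (L : ℕ) [NeZero L], L₀ ≤ L → Even L →
        a * s ≤ (hubbardTorus 2 L 1 U + ((s / (L : ℝ) ^ 4 : ℝ) : ℂ) •
            ((pairField dWaveFormFactor L)ᴴ * pairField dWaveFormFactor L)).minEnergyOn
            (szSector (2 * ⌊(1 - δ) * (L : ℝ) ^ 2 / 2⌋₊) 0) -
          (hubbardTorus 2 L 1 U).minEnergyOn (szSector (2 * ⌊(1 - δ) * (L : ℝ) ^ 2 / 2⌋₊) 0)) :
    LowEnergyRigidity := by
  obtain ⟨U, hU, δ, hδ, s, hs, a, ha, L₀, h⟩ := h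
  refine ⟨U, hU, δ, hδ, a * s / 2, by positivity, a / 2, by positivity, L₀,
    fun L _ hL hev φ hmem hφ1 hE => ?_⟩
  have key := lro_ge_of_penaltyGap L U hs _ (h L hL hev) hmem hφ1 hE
  have hid : (a * s - a * s / 2) / s = a / 2 := by
    rw [show a * s - a * s / 2 = (a / 2) * s by ring, mul_div_assoc, div_self hs.ne', mul_one]
  rwa [hid] at key

/-- **The target is as strong as the corner crux**: `LadderThesis → LowEnergyRigidity` (through the
uniform penalty gap, `κ = a s/2`, `a' = a/2`). Together with `ladderThesis_of_lowEnergyRigidity` the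
rank-0 target and the rank-2 crux of route `DeformationLadder` are EQUIVALENT statements.
Kaplan–Horsch–von der Linden (1989); Kato (1966) II-§5.4. [cite: KaplanHorschVonDerLinden1989] -/
theorem lowEnergyRigidity_of_ladderThesis (h : LadderThesis) : LowEnergyRigidity :=
  lowEnergyRigidity_of_penaltyGap (penaltyGap_of_ladderThesis h)

/-- **Normal form I**: `LadderThesis ↔ LowEnergyRigidity` — X of route `DeformationLadder` (some
penalised ground state keeps `d`-wave LRO) is exactly O(1)-scale phase rigidity of the pure model
(every sector state within O(1) total energy of the ground energy has `d`-wave LRO).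
Kaplan–Horsch–von der Linden (1989); Koma–Tasaki, J. Stat. Phys. 76 (1994) 745, p. 11 for context.
[cite: KaplanHorschVonDerLinden1989] -/
theorem ladderThesis_iff_lowEnergyRigidity : LadderThesis ↔ LowEnergyRigidity :=
  ⟨lowEnergyRigidity_of_ladderThesis, ladderThesis_of_lowEnergyRigidity⟩

/-- A uniform penalty gap implies `LadderThesis` (via low-energy rigidity and the rigidity
reduction; constants `s ↦ a s/128`, `a ↦ a/2`). Danskin/Kato one-sided slopes of the concave
penalised energy, in finite-size form. Kato (1966) II-§5.4. [cite: KaplanHorschVonDerLinden1989] -/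
theorem ladderThesis_of_penaltyGap
    (h : ∃ U : ℝ, 0 < U ∧ ∃ δ ∈ Set.Ioo (0:ℝ) (1 / 2), ∃ s : ℝ, 0 < s ∧ ∃ a : ℝ, 0 < a ∧ ∃ L₀ : ℕ,
      ∀ (L : ℕ) [NeZero L], L₀ ≤ L → Even L →
        a * s ≤ (hubbardTorus 2 L 1 U + ((s / (L : ℝ) ^ 4 : ℝ) : ℂ) •
            ((pairField dWaveFormFactor L)ᴴ * pairField dWaveFormFactor L)).minEnergyOn
            (szSector (2 * ⌊(1 - δ) * (L : ℝ) ^ 2 / 2⌋₊) 0) -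
          (hubbardTorus 2 L 1 U).minEnergyOn (szSector (2 * ⌊(1 - δ) * (L : ℝ) ^ 2 / 2⌋₊) 0)) :
    LadderThesis :=
  ladderThesis_of_lowEnergyRigidity (lowEnergyRigidity_of_penaltyGap h)

/-- **Normal form II**: `LadderThesis` ↔ the uniform penalty gap
`minEnergyOn (H_L + (s/L⁴)Δ_dᴴΔ_d) (szSector N_L 0) − minEnergyOn H_L (szSector N_L 0) ≥ a·s` for
some `U > 0`, `δ ∈ (0,1/2)`, `s > 0`, `a > 0` and all large even `L` — the "L-uniform slope of the
concave penalised energy" reading of the crux recorded on the ledger (refuter c2488848), here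
proved; it is also the window-`{0}`, tail-`0` case of route KacWindowPenalty's target.
Kato (1966) II-§5.4; Griffiths (1964). [cite: KaplanHorschVonDerLinden1989] -/
theorem ladderThesis_iff_penaltyGap :
    LadderThesis ↔
      ∃ U : ℝ, 0 < U ∧ ∃ δ ∈ Set.Ioo (0:ℝ) (1 / 2), ∃ s : ℝ, 0 < s ∧ ∃ a : ℝ, 0 < a ∧ ∃ L₀ : ℕ,
        ∀ (L : ℕ) [NeZero L], L₀ ≤ L → Even L →
          a * s ≤ (hubbardTorus 2 L 1 U + ((s / (L : ℝ) ^ 4 : ℝ) : ℂ) •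
              ((pairField dWaveFormFactor L)ᴴ * pairField dWaveFormFactor L)).minEnergyOn
              (szSector (2 * ⌊(1 - δ) * (L : ℝ) ^ 2 / 2⌋₊) 0) -
            (hubbardTorus 2 L 1 U).minEnergyOn (szSector (2 * ⌊(1 - δ) * (L : ℝ) ^ 2 / 2⌋₊) 0) :=
  ⟨penaltyGap_of_ladderThesis, ladderThesis_of_penaltyGap⟩

end NormalForms

/-! ### The link with route TwistGap's target `S⁺` -/

section TwistGap

/-- **A uniform penalty gap gives TwistGap's `S⁺`** with `(λ, c) = (1/s, a)`: for a unit sector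
vector `φ`, `E₀ + a s ≤ E_s ≤ Re⟨φ, H_L φ⟩ + s·LRO(φ)` (variational principle for the penalised
matrix), i.e. `a ≤ LRO(φ) + (1/s)(Re⟨φ, H_L φ⟩ − E₀)`. Tasaki (2020) §2.1.
[cite: KaplanHorschVonDerLinden1989] -/
theorem tgThesis_of_penaltyGap
    (h : ∃ U : ℝ, 0 < U ∧ ∃ δ ∈ Set.Ioo (0:ℝ) (1 / 2), ∃ s : ℝ, 0 < s ∧ ∃ a : ℝ, 0 < a ∧ ∃ L₀ : ℕ,
      ∀ (L : ℕ) [NeZero L], L₀ ≤ L → Even L →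
        a * s ≤ (hubbardTorus 2 L 1 U + ((s / (L : ℝ) ^ 4 : ℝ) : ℂ) •
            ((pairField dWaveFormFactor L)ᴴ * pairField dWaveFormFactor L)).minEnergyOn
            (szSector (2 * ⌊(1 - δ) * (L : ℝ) ^ 2 / 2⌋₊) 0) -
          (hubbardTorus 2 L 1 U).minEnergyOn (szSector (2 * ⌊(1 - δ) * (L : ℝ) ^ 2 / 2⌋₊) 0)) :
    TgThesis := by
  obtain ⟨U, hU, δ, hδ, s, hs, a, ha, L₀, h⟩ := h
  refine ⟨U, hU, δ, hδ, 1 / s, by positivity, a, ha, L₀, fun L _ hL hev φ hmem hφ1 => ?_⟩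
  have hgap := h L hL hev
  have hL4 : (0 : ℝ) < (L : ℝ) ^ 4 := by
    have : (0 : ℝ) < L := by exact_mod_cast Nat.pos_of_ne_zero (NeZero.ne L)
    positivity
  set P := (pairField dWaveFormFactor L)ᴴ * pairField dWaveFormFactor L with hP
  set N := 2 * ⌊(1 - δ) * (L : ℝ) ^ 2 / 2⌋₊ with hN
  have h1 := minEnergyOn_le_re_rayleigh
    (hubbardTorus 2 L 1 U + ((s / (L : ℝ) ^ 4 : ℝ) : ℂ) • P) (szSector N 0) hmem hφ1
  rw [add_mulVec, dotProduct_add, Complex.add_re, smul_mulVec, dotProduct_smul,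
    smul_eq_mul, Complex.re_ofReal_mul] at h1
  have h2 : a * s ≤ s / (L : ℝ) ^ 4 * (star φ ⬝ᵥ P *ᵥ φ).re +
      ((star φ ⬝ᵥ hubbardTorus 2 L 1 U *ᵥ φ).re -
        (hubbardTorus 2 L 1 U).minEnergyOn (szSector N 0)) := by linarith
  unfold expect
  -- divide by `s`
  have h3 : a = (a * s) * (1 / s) := by field_simp
  have h4 : (s / (L : ℝ) ^ 4 * (star φ ⬝ᵥ P *ᵥ φ).re +
      ((star φ ⬝ᵥ hubbardTorus 2 L 1 U *ᵥ φ).re -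
        (hubbardTorus 2 L 1 U).minEnergyOn (szSector N 0))) * (1 / s) =
      (star φ ⬝ᵥ P *ᵥ φ).re / (L : ℝ) ^ 4 +
        1 / s * ((star φ ⬝ᵥ hubbardTorus 2 L 1 U *ᵥ φ).re -
          (hubbardTorus 2 L 1 U).minEnergyOn (szSector N 0)) := by
    field_simp
  rw [h3, ← h4]
  exact mul_le_mul_of_nonneg_right h2 (by positivity)

/-- **TwistGap's `S⁺` gives low-energy rigidity** with `(κ, a) = (c/(2λ), c/2)`: if
`Re⟨φ, H_L φ⟩ − E₀ ≤ c/(2λ)` then `c ≤ LRO(φ) + λ·c/(2λ) = LRO(φ) + c/2`. [folklore] -/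
theorem lowEnergyRigidity_of_tgThesis (h : TgThesis) : LowEnergyRigidity := by
  obtain ⟨U, hU, δ, hδ, lam, hlam, c, hc, L₀, h⟩ := h
  refine ⟨U, hU, δ, hδ, c / (2 * lam), by positivity, c / 2, by positivity, L₀,
    fun L _ hL hev φ hmem hφ1 hE => ?_⟩
  have h1 := h L hL hev φ hmem hφ1
  unfold expect at h1
  have h2 : lam * ((star φ ⬝ᵥ hubbardTorus 2 L 1 U *ᵥ φ).re -
      (hubbardTorus 2 L 1 U).minEnergyOn (szSector (2 * ⌊(1 - δ) * (L : ℝ) ^ 2 / 2⌋₊) 0)) ≤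
      lam * (c / (2 * lam)) := mul_le_mul_of_nonneg_left (by linarith) hlam.le
  have h3 : lam * (c / (2 * lam)) = c / 2 := by field_simp
  unfold expect
  linarith

/-- **X ↔ TwistGap's target `S⁺`** (`TgThesis`, `stmt-HubbardSuperconductivity-1508`): the targets of
routes `DeformationLadder` and `TwistGap` are one statement up to constants. [folklore] -/
theorem ladderThesis_iff_tgThesis : LadderThesis ↔ TgThesis :=
  ⟨fun h => tgThesis_of_penaltyGap (penaltyGap_of_ladderThesis h),
    fun h => ladderThesis_of_lowEnergyRigidity (lowEnergyRigidity_of_tgThesis h)⟩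

/-- **`LowEnergyRigidity` ↔ TwistGap's `S⁺`** (the refuter certificate recorded on
`stmt-HubbardSuperconductivity-1892`, here as a theorem of the tree). [folklore] -/
theorem lowEnergyRigidity_iff_tgThesis : LowEnergyRigidity ↔ TgThesis :=
  ⟨fun h => ladderThesis_iff_tgThesis.1 (ladderThesis_of_lowEnergyRigidity h),
    lowEnergyRigidity_of_tgThesis⟩

end TwistGap

end Summit.HubbardSuperconductivity.HubbardSuperconductivity.Theorems.DeformationLadder
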